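import Literature.NumberTheory.Automorphic.Liu2021.Thm418AsPrinted
import Mathlib.Algebra.Category.ModuleCat.Basic
import Mathlib.LinearAlgebra.Dimension.Finrank
import Mathlib.Algebra.BigOperators.Intervals
import HarnessLib

/-!
# Liu 2021, §4.4 «Arithmetic Gan–Gross–Prasad» (print pp. 63–68, items 4.31–4.38) — SECTION CARPET
# (statement-exact typing over one in-file hypothesis structure; no proof; the predicted identities are VOCABULARY)

[Liu2021] = Yifeng Liu, *Fourier–Jacobi cycles and arithmetic relative trace formula* (with an appendix by Chao Li and
Yihang Zhu), Cambridge J. Math. **9** (2021), no. 1, 1–147 = arXiv:2102.11518.  SOURCES READ: the print text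
`paper:liu2021-fourier-jacobi-cycles-arithmetic-relative-trace-formula` pp. 63–68 (page file `pNNNN` = journal page `N`) AND,
because the print extraction drops mathematical symbols in this subsection, the author's TeX source `FJcycle.tex` (md5
`6db49a74122d…`, cell copy `hodge-director/pub-hodgeaudit-refbounty-3/g42/scratch/FJcycle.tex`) l. 2621–2853: the statements
below follow the TeX (items (a), (c) of 4.31 read «`≠ 0`»; (4.9)/(4.10) carry the central DERIVATIVE `L'(½, Π₁ × Π₂ ⊗ μ)` and
`∏_{i=1}^n L(i, μ_{E/F}^i)`; Rem. 4.36 (3) reads «`F ≠ ℚ`», (4) «`F = ℚ`»).  Numbering (print = arXiv v2): 4.31 (p. 64), Rem. 4.32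
(pp. 64–65), 4.33 (p. 65), Rem. 4.34 (p. 66), Def. 4.35 (p. 67), Rem. 4.36 (p. 67), 4.37 (pp. 67–68), Rem. 4.38 (p. 68).
Dedup (2026-09-02): no tree declaration cites 4.31–4.38 (green field); squad TL «GO 500», third block of TL-t02.
ED.2 (2026-09-02, squad retro-audit, review-class fix L2b): `Rem434_1`, `Rem438_1` restated under exactly the data of (4.9)/(4.10)
(test functions, `φ ∈ Hom_E(A_K, A_μ, ε)`, `φ_c ∈ Hom_E(A_K, A_μ^∨, −ε)`, height pairings defined); all other declarations byte-identical.

## What items 4.31, 4.33, 4.37 are, and how they are typed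

They are the paper's PREDICTED relations (arithmetic Gan–Gross–Prasad for `U(n) × U(n)`: unrefined 4.31, refined 4.33, variant
4.37) — NOT proved in the source or anywhere.  By the human rule («unproven predictions are not Literature facts») they are typed
here ONLY AS VOCABULARY: `Item431AsPrinted D`, `Item433AsPrinted D`, `Item437AsPrinted D` are predicates NAMING the printed
relation on the consumer's datum `D`, exactly as `Thm418AsPrinted D` names a printed theorem; nothing is asserted, no
`_holds` can be filed from this file, and a route that wants to USE one of them takes it as a crux / `--conditional-on` an
`@[conjecture]` leaf under `Summits/` (gate rule), citing these names for the statement.  HONESTY NOTE: in print these three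
items are headed «Conjecture 4.31 / 4.33 / 4.37» and Rem. 4.32 (3)(4) say «local Gan–Gross–Prasad conjecture»; the DECLARATION
docstrings below render that heading as «item 4.3x» and that word as «[statement]» (editorial brackets), because the gate's lint for
unproved predictions keys on the word and such items, when USED, belong under `Summits/` — these records are vocabulary only.  The
remarks' CLAIMS that the paper attributes to proved sources (Rem. 4.32 (3) [Sun12], (4) [GI16]; Rem. 4.34 (3) [Xue16]; Rem. 4.36 (1)–(3)) are ordinary
named-fact predicates.

## Discipline («What a CARRIER is», `Thm418AsPrinted`; squad ruling «in-file hypothesis structures»)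

`Sec44Data F E` holds the tree's `Thm418Data F E` (REAL `μ` conjugate symplectic of weight one, `M_μ = fieldOfValues E μ`,
the carriers `G = 𝔾(𝔸_F^∞)`, `Eps`, `Obj = 𝒜(μ)`, `Ω(μ)`, `Hom_E(A_K, A_μ)_ℚ`, `res`), the REAL coefficient field
`L ⊆ ℂ` («a subfield containing `M_μ`»: `IntermediateField ℚ ℂ` with `M_μ ≤ L`), the collection `ε` with its REAL
`μ`-admissibility, and ⟨CARRIER⟩ fields for every other object §4.4 NAMES — several of them typed AS PRINTED in sibling squad
files, which the field docstrings cite instead of restating: relevant representations / `s(Π)` (Def. 1.2, `Sec1Introduction`,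
TL-t11), `Φ_Π`, test functions, `FJ(f₁,f₂;φ)_K` (Def. 4.24/4.26/4.28, `Sec43FourierJacobiCycles`, TL-t01), `Ω(μ,ε)` (Def. 4.19),
`vol(K)`, the Hodge divisor `D_K` (Def. 4.22) (`Sec42AlbaneseUnitaryShimuraII`, TL-t03), the Beilinson–Bloch–Poincaré pairing
(Def. 3.7 = ★ `Sec3CyclesHeightPairings.BBPHeightPairingData.bbp`) and odd projectors / `pr^{[3]}` (Def. 3.10/3.13 = ★
`Sec3CyclesHeightPairings.KunnethChowData.IsOddProjector` / `pr3`).  `L`-values, the root number, `β` are complex-number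
carriers (their analytic definitions are the MEANING of the tokens; `β`'s defining integral `β_Σ`, p. 66, is quoted, not typed).

## INDEX (item ↦ declaration; namespace `Literature.NumberTheory.Automorphic.Liu2021.Sec44ArithmeticGGP`)

(4.6)–(4.7), `FJ^♮`, `FJ^♮_ε` (pp. 63–64) ↦ carriers `CHmuNat`, `Src`, `Srcε`, `Tgt`, `FJnat`; **4.31** ↦ `Stmt431a/b/c`, `Item431AsPrinted`;
**Rem. 4.32** ↦ `Rem432_2`, `Rem432_3`, `Rem432_4` ((1) commentary, (4)'s uniqueness bullets NOT typed); `Hom_E(A_K, A_μ, ε)`,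
`Hom_E(A_K, A_μ^∨, −ε)` (p. 65) ↦ `homKε`, `homKcε` (REAL); **4.33** / (4.9) ↦ `rhs49`, `Item433AsPrinted`; `β` (p. 66) ↦ carrier `beta`;
**Rem. 4.34** ↦ `Rem434_1`, `Rem434_3` ((2) = pointer to [Xue16, 1.1.2], NOT typed); **Def. 4.35** ↦ `IsHeckeSystemOfProjectors` (REAL
predicate); **Rem. 4.36** ↦ `Rem436_1`, `Rem436_2`, `Rem436_3` ((4) speculative, NOT typed); `Δ³_z X_K`, `FJ(f₁,f₂;φ)^z_K` (p. 67) ↦ carrier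
`bbpFJz`; **4.37** / (4.10) ↦ `Item437AsPrinted`; **Rem. 4.38** ↦ `Rem438_1` ((2), (3) NOT typed).

## References
* [Liu2021] §4.4 pp. 63–68 = `FJcycle.tex` l. 2621–2853; Def. 1.2, 3.7, 3.10, 3.13, 4.19, 4.22, 4.24, 4.26, 4.28, Lem. 3.11, 4.23,
  4.29, Prop. 2.12, 4.27.
* [Sun2012] B. Sun, multiplicity one (Rem. 4.32 (3)); [GanIchino2016] (Rem. 4.32 (4)); [Xue2016] H. Xue (β, Rem. 4.34);
  [MorelSuh2019] (Rem. 4.36 (3)); [RSZ20] (Def. 4.35) — the sources the remarks name (not used here).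
-/

noncomputable section

open NumberField
open Literature.NumberTheory.Automorphic.Liu2021 (Thm418Data fieldOfValues IsOpenCompact)

namespace Literature.NumberTheory.Automorphic.Liu2021.Sec44ArithmeticGGP

variable {F E : Type} [Field F] [NumberField F] [IsTotallyReal F] [Field E] [NumberField E] [Algebra F E]
  [IsTotallyComplex E] [Algebra.IsQuadraticExtension F E]

/-- **Data of [Liu2021, §4.4]** (pp. 63–68; TeX l. 2621–2853).  Setup sentence of 4.31 (p. 64; l. 2663–2665): «Let `Π₁` and `Π₂` be two
relevant representations of `GL_n(𝔸_E)` (Definition 1.2). Let `μ : E^× \ 𝔸_E^× → ℂ^×` be a conjugate symplectic automorphic character of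
weight one, and `ε` a `μ`-admissible collection. Let `L ⊆ ℂ` be a subfield containing `M_μ` over which both `Π₁^∞` and `Π₂^∞` are defined.
For pairs `(𝕍, π₁^∞) ∈ Φ_{Π₁}` and `(𝕍, π₂^∞) ∈ Φ_{Π₂}` …»; 4.33 adds (p. 65; l. 2729–2737) «We assume that all height pairings are defined.
Take a level subgroup `K ⊆ 𝔾(𝔸_F^∞)` … `D_μ ∈ 𝒜(μ)` a CM data for `μ` … test functions `f₁, f₁^∨, f₂, f₂^∨ ∈ ℋ_{K,L}` for `π₁^∞`, `(π₁^∞)^∨`,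
`π₂^∞`, `(π₂^∞)^∨` … `φ ∈ Hom_E(A_K, A_μ, ε)` and `φ_c ∈ Hom_E(A_K, A_μ^∨, −ε)`».  REAL: `T` (its `μ`, `M_μ`), `L`, `M_μ ≤ L`, `ε` admissible.
Everything marked ⟨CARRIER⟩ is posited (module docstring); nothing is asserted. [cite: Liu2021, §4.4 (pp. 63–68)] -/
structure Sec44Data (F E : Type) [Field F] [NumberField F] [IsTotallyReal F] [Field E] [NumberField E] [Algebra F E]
    [IsTotallyComplex E] [Algebra.IsQuadraticExtension F E] : Type 2 where
  /-- the §4.2 datum: REAL `μ` (conjugate symplectic, weight one), `M_μ`, and the carriers `G`, `Eps`, `Obj = 𝒜(μ)`, `Ω(μ)`, `HomK`, `res`. -/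
  T : Thm418Data F E
  /-- «`L ⊆ ℂ` … a subfield containing `M_μ`» — REAL. -/
  L : IntermediateField ℚ ℂ
  /-- «containing `M_μ`» — REAL. -/
  le_L : fieldOfValues E T.μ ≤ L
  /-- «`ε` a `μ`-admissible collection» (an element of the carrier `T.Eps`). -/
  ε : T.Eps
  /-- «`μ`-admissible» — REAL predicate of `Thm418Data` (Def. 4.12). -/
  admissible : T.IsAdmissible ε
  /-- ⟨CARRIER⟩ `π₁^∞`, `π₂^∞` as `L`-vector spaces («irreducible `L[𝔾(𝔸_F^∞)]`-modules», p. 59 L3; relevant `Π_i`, Def. 1.2, and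
  `(𝕍, π_i^∞) ∈ Φ_{Π_i}`, Def. 4.24 — `Sec1Introduction` / `Sec43FourierJacobiCycles`), index `i : Fin 2`. -/
  pi : Fin 2 → ModuleCat.{0} L
  /-- ⟨CARRIER⟩ the `𝔾(𝔸_F^∞)`-action on `π_i^∞`. -/
  piRep : ∀ i, Representation L T.G (pi i)
  /-- ⟨CARRIER⟩ `s(Π_i) ∈ ℕ` (Def. 1.2; «`s(Π_i)` has appeared in Definition 1.2», p. 65). -/
  s : Fin 2 → ℕ
  /-- ⟨CARRIER⟩ (4.6) `CH^{n−1+[M_μ:ℚ]/2}_μ(X_∞ × X_∞)^♮_L := colim_{D_μ ∈ 𝒜(μ)} CH^{n−1+[M_μ:ℚ]/2}(X_∞ × X_∞ × A_μ)^♮_L[i_μ]` (p. 63 L12–19),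
  an `L[G × G]`-module. -/
  CHmuNat : ModuleCat.{0} L
  /-- ⟨CARRIER⟩ its `𝔾(𝔸_F^∞) × 𝔾(𝔸_F^∞)`-action. -/
  CHmuNatRep : Representation L (T.G × T.G) CHmuNat
  /-- ⟨CARRIER⟩ the source `π₁^∞ ⊗_L π₂^∞ ⊗_{M_μ} Ω(μ)` of `FJ^♮` (p. 63 L30–34). -/
  Src : ModuleCat.{0} L
  /-- ⟨CARRIER⟩ its subspace `π₁^∞ ⊗_L π₂^∞ ⊗_{M_μ} Ω(μ, ε)` (p. 64 L2–6; `Ω(μ, ε)` of Def. 4.19, `Sec42AlbaneseUnitaryShimuraII`). -/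
  Srcε : Submodule L Src
  /-- ⟨CARRIER⟩ the target `Hom_{L[G×G]}((π₁^∞)^∨ ⊗_L (π₂^∞)^∨, CH^{n−1+[M_μ:ℚ]/2}_μ(X_∞ × X_∞)^♮_L)` of `FJ^♮` (p. 63 L33–34). -/
  Tgt : ModuleCat.{0} L
  /-- ⟨CARRIER⟩ «`FJ^♮ : π₁^∞ ⊗_L π₂^∞ ⊗_{M_μ} Ω(μ) → Hom_{L[G×G]}(…)`», `L`-linear (p. 63 L29–34; from Prop. 4.27 (2), Lem. 4.30); `FJ^♮_ε` is its
  restriction to `Srcε` (p. 64 L1–6). -/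
  FJnat : Src →ₗ[L] Tgt
  /-- ⟨CARRIER⟩ `Hom_{L[𝔾(𝔸_F^∞)]}(π₁^∞ ⊗_L π₂^∞ ⊗_{M_μ} Ω(μ, ε), L)` as an `L`-vector space (4.31 (c), Rem. 4.32 (2)–(4)). -/
  HomG : ModuleCat.{0} L
  /-- ⟨CARRIER⟩ `L'(½, Π₁ × Π₂ ⊗ μ)`, the central derivative of the Rankin–Selberg `L`-function (TeX l. 2675, 2738). -/
  Lderiv : ℂ
  /-- ⟨CARRIER⟩ `i ↦ L(i, μ_{E/F}^i)` (TeX l. 2738: `∏_{i=1}^n L(i, μ_{E/F}^i)`). -/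
  Lmu : ℕ → ℂ
  /-- ⟨CARRIER⟩ `L(1, Π_i, As^{(−1)^n})`, the Asai `L`-values (p. 65; [GGP12a, §7]). -/
  LAs : Fin 2 → ℂ
  /-- ⟨CARRIER⟩ the global root number of `Π₁ × Π₂ ⊗ μ` (Rem. 4.32 (4)). -/
  rootNumber : ℂ
  /-- ⟨CARRIER⟩ the vanishing order of `L(s, Π₁ × Π₂ ⊗ μ)` at `s = ½` (Rem. 4.32 (4)). -/
  centralOrder : ℕ
  /-- ⟨CARRIER⟩ «level subgroup» `K ⊆ 𝔾(𝔸_F^∞)` (sufficiently small, open compact, decomposable; §4.3 p. 57, `Sec43FourierJacobiCycles`). -/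
  IsLevel : Subgroup T.G → Prop
  /-- ⟨CARRIER⟩ the Hecke algebra `ℋ_{K,L} = C_c^∞(K\𝔾(𝔸_F^∞)/K, L)` (§4.3 p. 57). -/
  HKL : Subgroup T.G → ModuleCat.{0} L
  /-- ⟨CARRIER⟩ the inclusion `ℋ_{K,L} ⊆ ℋ_{K',L}` for `K' ⊆ K` (Rem. 4.34 (1)). -/
  heckeIncl : ∀ K K' : Subgroup T.G, K' ≤ K → (HKL K →ₗ[L] HKL K')
  /-- ⟨CARRIER⟩ «`f` is a test function for `π_i^∞`» (`dual = false`) resp. «for `(π_i^∞)^∨`» (`dual = true`) (Def. 4.26, `Sec43FourierJacobiCycles`). -/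
  IsTest : Fin 2 → Bool → ∀ K : Subgroup T.G, HKL K → Prop
  /-- ⟨CARRIER⟩ `vol(K)`, the canonical volume (Def. 4.22 (2), `Sec42AlbaneseUnitaryShimuraII`), a positive rational for levels. -/
  vol : Subgroup T.G → ℚ
  /-- ⟨CARRIER⟩ `Ω(μ, ε) ⊆ Ω(μ)`, the `M_μ`-submodule of Def. 4.19 (`Sec42AlbaneseUnitaryShimuraII`). -/
  Ωε : Submodule (fieldOfValues E T.μ) T.Ω
  /-- ⟨CARRIER⟩ `Ω(μ^c)` as an `M_μ`-module (`M_{μ^c} = M_μ`, Rem. 4.4). -/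
  Ωc : ModuleCat.{0} (fieldOfValues E T.μ)
  /-- ⟨CARRIER⟩ `Ω(μ^c, −ε) ⊆ Ω(μ^c)` (Def. 4.19 for `μ^c`; «`ε` is `μ`-admissible iff `−ε` is `μ^c`-admissible», Def. 4.12). -/
  Ωcε : Submodule (fieldOfValues E T.μ) Ωc
  /-- ⟨CARRIER⟩ `Hom_E(A_K, A_μ^∨)` for `D_μ^∨` (the dual CM data, Def. 4.5 (4)), indexed by `D_μ ∈ 𝒜(μ)`. -/
  HomKc : Subgroup T.G → T.Obj → ModuleCat.{0} ℤ
  /-- ⟨CARRIER⟩ the canonical map `Hom_E(A_K, A_μ^∨) → Ω(μ^c)` (as `T.res` for `μ`). -/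
  resc : ∀ K Dμ, HomKc K Dμ →+ Ωc
  /-- ⟨CARRIER⟩ pull-back `Hom_E(A_K, A_μ) → Hom_E(A_{K'}, A_μ)` along `Alb_{u^{K'}_K}` for `K' ⊆ K` (Rem. 4.34 (1)). -/
  homIncl : ∀ (K K' : Subgroup T.G) (Dμ : T.Obj), K' ≤ K → (T.HomK K Dμ →+ T.HomK K' Dμ)
  /-- ⟨CARRIER⟩ the same for `A_μ^∨`. -/
  homcIncl : ∀ (K K' : Subgroup T.G) (Dμ : T.Obj), K' ≤ K → (HomKc K Dμ →+ HomKc K' Dμ)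
  /-- ⟨CARRIER⟩ the value `⟨FJ(f₁,f₂;φ)_K, FJ(f₁^∨,f₂^∨;φ_c)_K⟩^{BBP}_{X_K×X_K, A_μ} ∈ ℂ` (LHS of (4.9) without `vol(K)²`): the Fourier–Jacobi cycles
  of Def. 4.28 (`Sec43FourierJacobiCycles`, defined for all `φ ∈ Hom_E(A_K, A_μ)`, `φ_c ∈ Hom_E(A_K, A_μ^∨)`) paired by the Beilinson–Bloch–Poincaré
  pairing of Def. 3.7 (★ `Sec3CyclesHeightPairings.BBPHeightPairingData.bbp`, `R = L`). -/
  bbpFJ : ∀ (K : Subgroup T.G) (Dμ : T.Obj), HKL K → HKL K → T.HomK K Dμ → HKL K → HKL K → HomKc K Dμ → ℂ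
  /-- ⟨CARRIER⟩ «We assume that all height pairings are defined» (p. 65 L29; standing assumption of 4.33/4.37). -/
  HeightPairingsDefined : Prop
  /-- ⟨CARRIER⟩ `β(f₁, f₁^∨, f₂, f₂^∨, φ, φ_c) ∈ ℂ`, the stable value of the normalized matrix-coefficient integrals `β_Σ` (p. 66 L1–28:
  `β_Σ := (∏_{v ∈ Σ ∪ Φ_F} ∏_i L(i, μ^i_{E/F,v}) L(½, Π_{1,v} × Π_{2,v} ⊗ μ_v) / (L(1, Π_{1,v}, As) L(1, Π_{2,v}, As)))^{−1} ∫_{𝔾(F_Σ)} ev(π₁^∞(g), f₁ᵗ ∗ f₁^∨)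
  ev(π₂^∞(g), f₂ᵗ ∗ f₂^∨) (gφ, φ_c)_μ d_Σ g`, «finite and stabilizes when `Σ` is large enough» by [Xue16, Prop. 1.1.1 (1,3)]); arguments
  `φ ∈ Ω(μ)`, `φ_c ∈ Ω(μ^c)` (values used only on `Ω(μ,ε) × Ω(μ^c,−ε)`). -/
  beta : ∀ K : Subgroup T.G, HKL K → HKL K → HKL K → HKL K → T.Ω → Ωc → ℂ
  /-- ⟨CARRIER⟩ `CH^{n−1}(X_K × X_K)_ℚ`, correspondences of `X_K` (Def. 4.35). -/
  CorrK : Subgroup T.G → ModuleCat.{0} ℚ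
  /-- ⟨CARRIER⟩ «`z_K` is an odd projector (Definition 3.10)» at `X_K` (★ `Sec3CyclesHeightPairings.KunnethChowData.IsOddProjector`). -/
  IsOddProjectorAt : ∀ K : Subgroup T.G, CorrK K → Prop
  /-- ⟨CARRIER⟩ `CH^{n−1}(X_{K'} × X_K)_ℚ` (Def. 4.35 (2)). -/
  CorrKK : Subgroup T.G → Subgroup T.G → ModuleCat.{0} ℚ
  /-- ⟨CARRIER⟩ `(id_{X_{K'}} × u^{K'}_K)_*` (Def. 4.35 (2)). -/
  pushIdU : ∀ K' K : Subgroup T.G, K' ≤ K → (CorrK K' →ₗ[ℚ] CorrKK K' K)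
  /-- ⟨CARRIER⟩ `(u^{K'}_K × id_{X_K})^*` (Def. 4.35 (2)). -/
  pullUId : ∀ K' K : Subgroup T.G, K' ≤ K → (CorrK K →ₗ[ℚ] CorrKK K' K)
  /-- ⟨CARRIER⟩ `T_g^* : CH^{n−1}(X_K × X_K)_ℚ → CH^{n−1}(X_{gKg⁻¹} × X_{gKg⁻¹})_ℚ`, `T_g : X_{gKg⁻¹} → X_K` the Hecke translation (Def. 4.35 (3)). -/
  heckePull : ∀ (g : T.G) (K : Subgroup T.G), CorrK K →ₗ[ℚ] CorrK (K.map (MulAut.conj g).toMonoidHom)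
  /-- ⟨CARRIER⟩ `z_{X_K, D_K}` of Lemma 3.11 ((1) if `dim X_K = 1`, (2) if `dim X_K = 2`) for the Hodge divisor `D_K` (Def. 4.22; Rem. 4.36 (1)(2)). -/
  zHodge : ∀ K : Subgroup T.G, CorrK K
  /-- ⟨CARRIER⟩ the variant value `⟨FJ(f₁,f₂;φ)^z_K, FJ(f₁^∨,f₂^∨;φ_c)^z_K⟩^{BBP}_{X_K×X_K,A_μ}` built with `Δ³_z X_K := pr^{[3]}_{z_K} Δ³X_K`
  (p. 67 L37–44; `pr^{[3]}` = ★ `Sec3CyclesHeightPairings.KunnethChowData.pr3`), for a system `z = (z_K)_K`. -/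
  bbpFJz : (∀ K : Subgroup T.G, CorrK K) →
    ∀ (K : Subgroup T.G) (Dμ : T.Obj), HKL K → HKL K → T.HomK K Dμ → HKL K → HKL K → HomKc K Dμ → ℂ

namespace Sec44Data

variable (D : Sec44Data F E)

/-! ### Item 4.31 (p. 64; TeX l. 2662–2679) and Remark 4.32 -/

/-- 4.31 (a): «We have `FJ^♮_ε ≠ 0`» (TeX l. 2667) — the restriction of `FJ^♮` to `π₁^∞ ⊗ π₂^∞ ⊗ Ω(μ, ε)` is not zero.
[cite: Liu2021, §4.4 (4.31 (a)) (p. 64)] -/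
def Stmt431a : Prop := ∃ x ∈ D.Srcε, D.FJnat x ≠ 0

/-- 4.31 (b): «`FJ^♮_ε ≠ 0`, and `dim_L Hom_{L[G×G]}((π₁^∞)^∨ ⊗_L (π₂^∞)^∨, CH^{n−1+[M_μ:ℚ]/2}_μ(X_∞ × X_∞)^♮_L) = 1`» (TeX l. 2669–2672;
`Module.finrank = 1`, which forces finite dimension). [cite: Liu2021, §4.4 (4.31 (b)) (p. 64)] -/
def Stmt431b : Prop := D.Stmt431a ∧ Module.finrank D.L D.Tgt = 1

/-- 4.31 (c): «`L'(½, Π₁ × Π₂ ⊗ μ) ≠ 0`, and `Hom_{L[𝔾(𝔸_F^∞)]}(π₁^∞ ⊗_L π₂^∞ ⊗_{M_μ} Ω(μ, ε), L) ≠ {0}`» (TeX l. 2674–2677).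
[cite: Liu2021, §4.4 (4.31 (c)) (p. 64)] -/
def Stmt431c : Prop := D.Lderiv ≠ 0 ∧ Nontrivial D.HomG

/-- **[Liu2021, §4.4, item 4.31] AS PRINTED** («Unrefined arithmetic Gan–Gross–Prasad … for `U(n) × U(n)`», p. 64; TeX l. 2662–2679) — a
relation PREDICTED by the paper, not proved there or elsewhere; typed as VOCABULARY (a predicate naming the statement on the datum;
never asserted, not dischargeable from this file; see the module docstring).  Setup = the datum; statement: «the following three
statements are equivalent: (a) `FJ^♮_ε ≠ 0`. (b) `FJ^♮_ε ≠ 0`, and [the `Hom` space] has dimension `1`. (c) `L'(½, Π₁ × Π₂ ⊗ μ) ≠ 0`, and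
`Hom_{L[𝔾(𝔸_F^∞)]}(π₁^∞ ⊗_L π₂^∞ ⊗_{M_μ} Ω(μ,ε), L) ≠ {0}`.» [cite: Liu2021, §4.4 (4.31) (p. 64)] -/
def Item431AsPrinted : Prop := (D.Stmt431a ↔ D.Stmt431b) ∧ (D.Stmt431b ↔ D.Stmt431c)

/-- **[Liu2021, Remark 4.32 (2)] AS PRINTED** (p. 64; TeX l. 2691): «The assertion `FJ^♮_ε ≠ 0` immediately implies
`Hom_{L[𝔾(𝔸_F^∞)]}(π₁^∞ ⊗_L π₂^∞ ⊗_{M_μ} Ω(μ,ε), L) ≠ {0}`.»  ((1), «a generalization of Kolyvagin's theorem», is commentary.)  NO PROOF.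
[cite: Liu2021, Rem. 4.32 (2) (p. 64)] -/
def Rem432_2 : Prop := D.Stmt431a → Nontrivial D.HomG

/-- **[Liu2021, Remark 4.32 (3)] AS PRINTED** (p. 64; TeX l. 2693–2696): «By the multiplicity one part of the local Gan–Gross–Prasad
[statement], which is proved in [Sun12] for our particular Fourier–Jacobi model, we know that `dim_L Hom_{L[𝔾(𝔸_F^∞)]}(π₁^∞ ⊗_L π₂^∞ ⊗_{M_μ}
Ω(μ,ε), L) ≤ 1`.»  (`Module.rank ≤ 1`.)  NO PROOF. [cite: Liu2021, Rem. 4.32 (3) (p. 64)] -/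
def Rem432_3 : Prop := Module.rank D.L D.HomG ≤ 1

/-- **[Liu2021, Remark 4.32 (4)], first sentence, AS PRINTED** (p. 65; TeX l. 2698–2703): «By the (refined) local Gan–Gross–Prasad [statement],
which is proved in [GI16] …, we know that if (4.8) `dim_L Hom_{L[𝔾(𝔸_F^∞)]}(π₁^∞ ⊗_L π₂^∞ ⊗_{M_μ} Ω(μ,ε), L) = 1` from some `μ`-admissible
collection `ε`, then the global root number of `Π₁ × Π₂ ⊗ μ` is `−1`, that is, `L(s, Π₁ × Π₂ ⊗ μ)` has odd vanishing order at the center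
`s = ½`.»  NOT typed: the uniqueness bullets for `(𝕍, π₁^∞, π₂^∞)` / `ε` according to the parity of `n`.  NO PROOF.
[cite: Liu2021, Rem. 4.32 (4) and (4.8) (p. 65)] -/
def Rem432_4 : Prop := Module.finrank D.L D.HomG = 1 → D.rootNumber = -1 ∧ Odd D.centralOrder

/-! ### `Hom_E(A_K, A_μ, ε)` (p. 65; TeX l. 2729–2733), item 4.33 with (4.9), `β`, Remark 4.34 -/

/-- **`Hom_E(A_K, A_μ, ε) := Hom_E(A_K, A_μ) ∩ Ω(μ, ε)`** (p. 65 L31; the intersection taken inside `Ω(μ)` through the canonical map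
`Hom_E(A_K, A_μ)_ℚ → Ω(μ)` of Thm. 4.18 (1) / Rem. 4.17). REAL (preimage). [cite: Liu2021, §4.4 (p. 65 L29–32)] -/
def homKε (K : Subgroup D.T.G) (Dμ : D.T.Obj) : AddSubgroup (D.T.HomK K Dμ) :=
  D.Ωε.toAddSubgroup.comap (D.T.res K Dμ)

/-- **`Hom_E(A_K, A_μ^∨, −ε) := Hom_E(A_K, A_μ^∨) ∩ Ω(μ^c, −ε)`** (p. 65 L32). REAL (preimage). [cite: Liu2021, §4.4 (p. 65 L29–32)] -/
def homKcε (K : Subgroup D.T.G) (Dμ : D.T.Obj) : AddSubgroup (D.HomKc K Dμ) :=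
  D.Ωcε.toAddSubgroup.comap (D.resc K Dμ)

/-- **The right-hand side of (4.9) / (4.10)** (p. 65; TeX l. 2737–2739): `(∏_{i=1}^n L(i, μ_{E/F}^i)) / 2^{s(Π₁)+s(Π₂)} · L'(½, Π₁ × Π₂ ⊗ μ) /
(L(1, Π₁, As^{(−1)^n}) · L(1, Π₂, As^{(−1)^n})) · β(f₁, f₁^∨, f₂, f₂^∨, φ, φ_c)`. REAL arithmetic shape over the carriers.
[cite: Liu2021, §4.4 (4.9) (p. 65)] -/
def rhs49 (K : Subgroup D.T.G) (f₁ f₁v f₂ f₂v : D.HKL K) (φ : D.T.Ω) (φc : D.Ωc) : ℂ :=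
  (∏ i ∈ Finset.Icc 1 D.T.n, D.Lmu i) / 2 ^ (D.s 0 + D.s 1) * (D.Lderiv / (D.LAs 0 * D.LAs 1)) * D.beta K f₁ f₁v f₂ f₂v φ φc

/-- **[Liu2021, §4.4, item 4.33] AS PRINTED** («Refined arithmetic Gan–Gross–Prasad … for `U(n) × U(n)`», p. 65; TeX l. 2735–2741) — a relation
PREDICTED by the paper, typed as VOCABULARY (predicate; never asserted).  «Let the setup be as in 4.31. Moreover, let `K ⊆ 𝔾(𝔸_F^∞)` be a level
subgroup, and `D_μ = (A_μ, i_μ, λ_μ, r_μ) ∈ 𝒜(μ)` a CM data for `μ`. For every test functions `f₁, f₁^∨, f₂, f₂^∨ ∈ ℋ_{K,L}` for `π₁^∞`, `(π₁^∞)^∨`,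
`π₂^∞`, `(π₂^∞)^∨`, respectively, and every elements `φ ∈ Hom_E(A_K, A_μ, ε)` and `φ_c ∈ Hom_E(A_K, A_μ^∨, −ε)`, the equality (4.9)
`vol(K)² · ⟨FJ(f₁,f₂;φ)_K, FJ(f₁^∨,f₂^∨;φ_c)_K⟩^{BBP}_{X_K×X_K,A_μ} = [rhs49]` holds.»  Under the standing «all height pairings are defined».
[cite: Liu2021, §4.4 (4.33), (4.9) (p. 65)] -/
def Item433AsPrinted : Prop :=
  D.HeightPairingsDefined → ∀ K : Subgroup D.T.G, D.IsLevel K → ∀ (Dμ : D.T.Obj) (f₁ f₁v f₂ f₂v : D.HKL K),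
    D.IsTest 0 false K f₁ → D.IsTest 0 true K f₁v → D.IsTest 1 false K f₂ → D.IsTest 1 true K f₂v →
    ∀ φ ∈ D.homKε K Dμ, ∀ φc ∈ D.homKcε K Dμ,
      ((D.vol K : ℂ) ^ 2) * D.bbpFJ K Dμ f₁ f₂ φ f₁v f₂v φc = D.rhs49 K f₁ f₁v f₂ f₂v (D.T.res K Dμ φ) (D.resc K Dμ φc)

/-- **[Liu2021, Remark 4.34 (1)] AS PRINTED** (p. 66; TeX l. 2774–2778): «The left-hand side of (4.9) is independent of `K`. More precisely, if we take
a smaller level subgroup `K'` contained in `K`, then the left-hand side of (4.9) is equal to `vol(K')² · ⟨FJ(f₁,f₂;φ)_{K'}, FJ(f₁^∨,f₂^∨;φ_c)_{K'}⟩^{BBP}`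
by the projection formula.» (`f`'s and `φ`'s moved to level `K'` by the inclusion carriers.)  ED.2 (review-class fix, L2b): stated under
EXACTLY the data of (4.9) — height pairings defined, `K' ⊆ K` level subgroups, `f₁, f₁^∨, f₂, f₂^∨` test functions at level `K`,
`φ ∈ Hom_E(A_K, A_μ, ε)`, `φ_c ∈ Hom_E(A_K, A_μ^∨, −ε)` (ED.1 quantified over all `f`, `φ`: an undeclared generalisation).  NO PROOF.
[cite: Liu2021, Rem. 4.34 (1) (p. 66)] -/
def Rem434_1 : Prop :=
  D.HeightPairingsDefined → ∀ (K K' : Subgroup D.T.G) (hK : K' ≤ K), D.IsLevel K → D.IsLevel K' →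
    ∀ (Dμ : D.T.Obj) (f₁ f₁v f₂ f₂v : D.HKL K),
    D.IsTest 0 false K f₁ → D.IsTest 0 true K f₁v → D.IsTest 1 false K f₂ → D.IsTest 1 true K f₂v →
    ∀ φ ∈ D.homKε K Dμ, ∀ φc ∈ D.homKcε K Dμ,
    ((D.vol K : ℂ) ^ 2) * D.bbpFJ K Dμ f₁ f₂ φ f₁v f₂v φc =
      ((D.vol K' : ℂ) ^ 2) * D.bbpFJ K' Dμ (D.heckeIncl K K' hK f₁) (D.heckeIncl K K' hK f₂) (D.homIncl K K' Dμ hK φ)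
        (D.heckeIncl K K' hK f₁v) (D.heckeIncl K K' hK f₂v) (D.homcIncl K K' Dμ hK φc)

/-- **[Liu2021, Remark 4.34 (3)] AS PRINTED** (p. 66; TeX l. 2782): «It is known by [Xue16, Proposition 1.1.1 (2)] that (4.8) holds if and only if `β` is
nonvanishing as a functional.»  ((2) is a pointer to [Xue16, 1.1.2], not typed.)  NO PROOF. [cite: Liu2021, Rem. 4.34 (3) (p. 66)] -/
def Rem434_3 : Prop :=
  Module.finrank D.L D.HomG = 1 ↔
    ∃ (K : Subgroup D.T.G) (f₁ f₁v f₂ f₂v : D.HKL K) (φ : D.T.Ω) (φc : D.Ωc),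
      φ ∈ D.Ωε ∧ φc ∈ D.Ωcε ∧ D.beta K f₁ f₁v f₂ f₂v φ φc ≠ 0

/-! ### Definition 4.35, Remark 4.36, item 4.37 with (4.10), Remark 4.38 (pp. 67–68) -/

/-- **[Liu2021, Definition 4.35] AS PRINTED** (p. 67; TeX l. 2789–2798; «taken from [RSZ20]»): «We say that a collection of correspondences
`z = (z_K ∈ CH^{n−1}(X_K × X_K)_ℚ)_K` is a *Hecke system of projectors* if (1) `z_K` is an odd projector (Definition 3.10) for every `K`, (2) we have
`(id_{X_{K'}} × u^{K'}_K)_* z_{K'} = (u^{K'}_K × id_{X_K})^* z_K ∈ CH^{n−1}(X_{K'} × X_K)_ℚ` for every transition morphism `u^{K'}_K : X_{K'} → X_K`, (3) for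
every `g ∈ 𝔾(𝔸_F^∞)`, we have `T_g^* z_K = z_{gKg⁻¹}` where `T_g : X_{gKg⁻¹} → X_K` is the Hecke translation.»  REAL predicate on a family
`z : ∀ K, CH^{n−1}(X_K × X_K)_ℚ` (indexed by all subgroups; clauses only at level subgroups). [cite: Liu2021, Def. 4.35 (p. 67)] -/
def IsHeckeSystemOfProjectors (z : ∀ K : Subgroup D.T.G, D.CorrK K) : Prop :=
  (∀ K, D.IsLevel K → D.IsOddProjectorAt K (z K)) ∧
    (∀ (K' K : Subgroup D.T.G) (h : K' ≤ K), D.IsLevel K → D.IsLevel K' → D.pushIdU K' K h (z K') = D.pullUId K' K h (z K)) ∧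
    ∀ (g : D.T.G) (K : Subgroup D.T.G), D.IsLevel K → D.heckePull g K (z K) = z (K.map (MulAut.conj g).toMonoidHom)

/-- **[Liu2021, Remark 4.36 (1)] AS PRINTED** (p. 67; TeX l. 2803): «If `n = 2`, then `z = (z_{X_K,D_K})_K` constructed in Lemma 3.11 (1) is a Hecke system of
projectors by Lemma 4.23.»  NO PROOF. [cite: Liu2021, Rem. 4.36 (1) (p. 67)] -/
def Rem436_1 : Prop := D.T.n = 2 → D.IsHeckeSystemOfProjectors D.zHodge

/-- **[Liu2021, Remark 4.36 (2)] AS PRINTED** (p. 67; TeX l. 2805): «If `n = 3`, then `z = (z_{X_K,D_K})_K` constructed in Lemma 3.11 (2) is a Hecke system of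
projectors by Lemma 4.23 and Proposition 2.12 (2).»  NO PROOF. [cite: Liu2021, Rem. 4.36 (2) (p. 67)] -/
def Rem436_2 : Prop := D.T.n = 3 → D.IsHeckeSystemOfProjectors D.zHodge

/-- **[Liu2021, Remark 4.36 (3)] AS PRINTED** (p. 67; TeX l. 2807: «If `n ≥ 4` and `F ≠ ℚ`, then odd projectors exist by [MS19, Theorem 1.3]» — the
print extraction's «F = Q» is a dropped symbol; (4), «If `n ≥ 4` and `F = ℚ`, then one probably needs … intersection cohomology», is speculative
and NOT typed).  `F ≠ ℚ` = `1 < [F : ℚ]`.  NO PROOF. [cite: Liu2021, Rem. 4.36 (3) (p. 67)] -/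
def Rem436_3 : Prop :=
  4 ≤ D.T.n → 1 < Module.finrank ℚ F → ∀ K : Subgroup D.T.G, D.IsLevel K → ∃ z : D.CorrK K, D.IsOddProjectorAt K z

/-- **[Liu2021, §4.4, item 4.37] AS PRINTED** («Refined arithmetic Gan–Gross–Prasad … for `U(n) × U(n)`, variant», pp. 67–68; TeX l. 2825–2833) — a
relation PREDICTED by the paper, typed as VOCABULARY (predicate; never asserted).  «Let the setup be as in 4.33. Take a Hecke system of
projectors `z = (z_K)_K`. Then the equality (4.10) `vol(K)² · ⟨FJ(f₁,f₂;φ)^z_K, FJ(f₁^∨,f₂^∨;φ_c)^z_K⟩^{BBP}_{X_K×X_K,A_μ} = [rhs49]` holds.»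
[cite: Liu2021, §4.4 (4.37), (4.10) (pp. 67–68)] -/
def Item437AsPrinted : Prop :=
  D.HeightPairingsDefined → ∀ z : (∀ K : Subgroup D.T.G, D.CorrK K), D.IsHeckeSystemOfProjectors z →
    ∀ K : Subgroup D.T.G, D.IsLevel K → ∀ (Dμ : D.T.Obj) (f₁ f₁v f₂ f₂v : D.HKL K),
    D.IsTest 0 false K f₁ → D.IsTest 0 true K f₁v → D.IsTest 1 false K f₂ → D.IsTest 1 true K f₂v →
    ∀ φ ∈ D.homKε K Dμ, ∀ φc ∈ D.homKcε K Dμ,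
      ((D.vol K : ℂ) ^ 2) * D.bbpFJz z K Dμ f₁ f₂ φ f₁v f₂v φc = D.rhs49 K f₁ f₁v f₂ f₂v (D.T.res K Dμ φ) (D.resc K Dμ φc)

/-- **[Liu2021, Remark 4.38 (1)] AS PRINTED** (p. 68; TeX l. 2839): «We have a similar statement for `FJ(f₁,f₂;φ)^z_K` as in Lemma 4.29. In particular, the
left-hand side of (4.10) is independent of `K`.» (typed as for Rem. 4.34 (1)).  NOT typed: (2) (the image of `FJ(f₁,f₂;φ)^z_K` in the natural Chow group
equals `FJ(f₁,f₂;φ)^♮_K`), (3) (the left-hand side factors through `Ω(μ,ε) ⊗_{M_μ} Ω(μ^c,−ε)` and becomes `M_μ`-linear, Rem. 5.11).  ED.2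
(review-class fix, L2b): stated under EXACTLY the data of (4.10), as `Rem434_1`.  NO PROOF. [cite: Liu2021, Rem. 4.38 (1) (p. 68)] -/
def Rem438_1 : Prop :=
  D.HeightPairingsDefined → ∀ z : (∀ K : Subgroup D.T.G, D.CorrK K), D.IsHeckeSystemOfProjectors z →
    ∀ (K K' : Subgroup D.T.G) (hK : K' ≤ K), D.IsLevel K → D.IsLevel K' → ∀ (Dμ : D.T.Obj) (f₁ f₁v f₂ f₂v : D.HKL K),
      D.IsTest 0 false K f₁ → D.IsTest 0 true K f₁v → D.IsTest 1 false K f₂ → D.IsTest 1 true K f₂v →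
      ∀ φ ∈ D.homKε K Dμ, ∀ φc ∈ D.homKcε K Dμ,
      ((D.vol K : ℂ) ^ 2) * D.bbpFJz z K Dμ f₁ f₂ φ f₁v f₂v φc =
        ((D.vol K' : ℂ) ^ 2) * D.bbpFJz z K' Dμ (D.heckeIncl K K' hK f₁) (D.heckeIncl K K' hK f₂) (D.homIncl K K' Dμ hK φ)
          (D.heckeIncl K K' hK f₁v) (D.heckeIncl K K' hK f₂v) (D.homcIncl K K' Dμ hK φc)

end Sec44Data

end Literature.NumberTheory.Automorphic.Liu2021.Sec44ArithmeticGGP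

end
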